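import Literature.NumberTheory.Automorphic.SymplecticSimilitudeSatakeTransform
import HarnessLib

/-!
# The Satake transform of a normalising (e.g. central) double coset is a monomial; the operator `Δ = [K₀ (ϖ·1) K₀]` of
# `GSp_{2n}` (Andrianov–Zhuravlev's `[p]`)

Topic `NumberTheory/Automorphic`; namespaces `Literature.NumberTheory.Automorphic.IsIwasawaExponent` (§1, abstract) and
`Literature.NumberTheory.Automorphic.SymplecticCartan` (§2, `GSp_{2n}`) (lane `lit-hodgefound`, Track 2 foundations; seat
`lit-hodgefound-p11`, generation 37, row g37-#19).  THEOREMS ONLY: no definition, no named fact, no instance, no notation.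
Sequel of `SatakeTransformIwasawa` (abstract transform `h.satakeTransform w`, `satakeTransform_doubleCosetOperator`) and
`SymplecticSimilitudeSatakeTransform` (`similitudeSatakeTransform`; torus representatives `similitudeTorusElt`).

## The print

[ShimuraIATAF1971] Prop. 3.17 / the tree's `doubleCosetOperator_central_mul` («`T(c, …, c) T(b) = T(cb)`»: for `z`
central `K z K = z K` is one coset); [CartierCorvallis1979] §IV (4.2) (`S(𝟙_{zK}) = δ(z)^{1/2} · [z]`);
[AndrianovZhuravlev1995] Ch. 3 §3.3 (the element `Δ = [p] = (Γ₀ p1_{2n} Γ₀)` of the Hecke ring of `GSp_n`, invertible in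
`L_{0,p}`, `Ω([p]) = p^{…} x₀² x₁ ⋯ x_n` in their coordinates): here, in the coordinates `(a, c) ∈ ℤⁿ × ℤ` of
`SymplecticSimilitudeIwasawa` and the weight `q^{⟨ρ, a⟩}`, **`𝒮(Δ) = q^{⟨ρ, (1,…,1)⟩} x^{((1,…,1), 2)}`**,
`⟨ρ, (1, …, 1)⟩ = Σᵢ (n - i) = n(n+1)/2`.

## What is formalised

* §1 (abstract, `h : IsIwasawaExponent P K a`) `orbit_coe_eq_singleton_of_forall_conj_mem` (`KzK = zK` when `z⁻¹Kz ⊆ K`),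
  **`satakeTransform_doubleCosetOperator_of_forall_conj_mem`** (`𝒮(T_z) = w(a z) x^{a z}`), `…_of_central`,
  `heckeEigencharacter_doubleCosetOperator_of_central` (`λ_χ(T_z) = w(a z) χ(a z)`).
* §2 (`GSp_{2n}`, `n ≠ 0`) `coe_coe_similitudeTorusElt_two_neg_one` (`t(2, -1) = ϖ·1`), `similitudeTorusElt_two_neg_one_central`,
  `symplecticRhoPairing_const_one` (`⟨ρ, (1,…,1)⟩ · 2 = n(n+1)`), `similitudeIwasawaExp_smul_one`, **`similitudeSatakeTransform_delta`**
  (`𝒮(T_{ϖ·1}) = q^{⟨ρ,(1,…,1)⟩} x^{((1,…,1),2)}`), `similitudeHeckeEigencharacter_delta`.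

## References
* [ShimuraIATAF1971] G. Shimura, *Introduction to the Arithmetic Theory of Automorphic Functions* (1971), Prop. 3.17.
* [CartierCorvallis1979] P. Cartier, *Representations of 𝔭-adic groups: a survey*, PSPM 33.1 (1979), §IV (4.2).
* [AndrianovZhuravlev1995] A. N. Andrianov, V. G. Zhuravlev, *Modular Forms and Hecke Operators* (1995), Ch. 3 §3.3.
-/

noncomputable section

open scoped Valued WithZero MatrixGroups
open MulAction MonoidAlgebra Representation Finset

namespace Literature.NumberTheory.Automorphic

variable {G : Type*} [Group G] {Λ : Type*} [AddCommGroup Λ] {R : Type*} [CommRing R]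

namespace IsIwasawaExponent

/-! ## §1 Normalising double cosets are single cosets; their transform is a monomial -/

/-- **`K z K = z K` when `z⁻¹ K z ⊆ K`** (e.g. `z` central): the `K`-orbit of `zK` in `G/K` is `{zK}`.
[cite: ShimuraIATAF1971, Prop. 3.17] -/
theorem orbit_coe_eq_singleton_of_forall_conj_mem (K : Subgroup G) {z : G} (hz : ∀ k ∈ K, z⁻¹ * k * z ∈ K) :
    orbit K (z : G ⧸ K) = {(z : G ⧸ K)} := by
  ext γ
  rw [Set.mem_singleton_iff, MulAction.mem_orbit_iff]
  constructor
  · rintro ⟨k, rfl⟩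
    change (((k : G) * z : G) : G ⧸ K) = (z : G ⧸ K)
    rw [QuotientGroup.eq, mul_inv_rev]
    exact hz _ (K.inv_mem k.2)
  · rintro rfl
    exact ⟨1, one_smul _ _⟩

variable {P K : Subgroup G} {a : G → Λ} [IsHeckeTriple (⊤ : Submonoid G) K K]

/-- **The transform of a normalising double coset is a monomial**: if `z⁻¹ K z ⊆ K` then `𝒮_w(T_z) = w(a z) x^{a z}`.
[cite: CartierCorvallis1979, §IV (4.2)] [cite: ShimuraIATAF1971, Prop. 3.17] -/
theorem satakeTransform_doubleCosetOperator_of_forall_conj_mem (h : IsIwasawaExponent P K a) (w : Multiplicative Λ →* R)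
    {z : G} (hz : ∀ k ∈ K, z⁻¹ * k * z ∈ K) :
    h.satakeTransform w (heckeAlgebra.doubleCosetOperator K z) =
      AddMonoidAlgebra.single (a z) (w (Multiplicative.ofAdd (a z))) := by
  classical
  rw [h.satakeTransform_doubleCosetOperator]
  have hset : (finite_orbit_quotient K z).toFinset = {(z : G ⧸ K)} := by
    rw [← Finset.coe_inj, Set.Finite.coe_toFinset, Finset.coe_singleton]
    exact orbit_coe_eq_singleton_of_forall_conj_mem K hz
  rw [hset, Finset.sum_singleton, h.apply_out_coe]

/-- **Central double cosets**: for `z` central, `𝒮_w(T_z) = w(a z) x^{a z}`. [cite: CartierCorvallis1979, §IV (4.2)]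
[cite: ShimuraIATAF1971, Prop. 3.17] -/
theorem satakeTransform_doubleCosetOperator_of_central (h : IsIwasawaExponent P K a) (w : Multiplicative Λ →* R)
    {z : G} (hz : ∀ x : G, x * z = z * x) :
    h.satakeTransform w (heckeAlgebra.doubleCosetOperator K z) =
      AddMonoidAlgebra.single (a z) (w (Multiplicative.ofAdd (a z))) :=
  h.satakeTransform_doubleCosetOperator_of_forall_conj_mem w fun k hk => by
    rwa [mul_assoc, hz, ← mul_assoc, inv_mul_cancel, one_mul]

/-- **The eigenvalue of a central double coset**: `λ_χ(T_z) = w(a z) χ(a z)`. [cite: CartierCorvallis1979, §IV (4.2)–(4.4)] -/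
theorem heckeEigencharacter_doubleCosetOperator_of_central (h : IsIwasawaExponent P K a) (w χ : Multiplicative Λ →* R)
    {z : G} (hz : ∀ x : G, x * z = z * x) :
    h.heckeEigencharacter w χ (heckeAlgebra.doubleCosetOperator K z) =
      w (Multiplicative.ofAdd (a z)) * χ (Multiplicative.ofAdd (a z)) := by
  rw [heckeEigencharacter_apply, h.satakeTransform_doubleCosetOperator_of_central w hz, AddMonoidAlgebra.lift_single,
    smul_eq_mul]

end IsIwasawaExponent

/-! ## §2 The operator `Δ = [K₀ (ϖ·1) K₀]` of `GSp_{2n}` -/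

namespace SymplecticCartan

open Literature.NumberTheory.Automorphic.CartanUnique

variable {K : Type*} [Field K] {n : ℕ}

/-- `t(2, -1) = diag(ϖ² ϖ⁻¹; ϖ) = ϖ · 1`. [cite: AndrianovZhuravlev1995, Ch. 3 §3.3] -/
theorem coe_coe_similitudeTorusElt_two_neg_one {ϖ : K} (hϖ0 : ϖ ≠ 0) :
    (((similitudeTorusElt hϖ0 2 (fun _ : Fin n => (-1 : ℤ)) : symplecticSimilitudeGroup (Fin n) K) : GL (Fin n ⊕ Fin n) K) :
        Matrix (Fin n ⊕ Fin n) (Fin n ⊕ Fin n) K) = ϖ • (1 : Matrix (Fin n ⊕ Fin n) (Fin n ⊕ Fin n) K) := by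
  rw [coe_coe_similitudeTorusElt, Matrix.smul_one_eq_diagonal]
  congr 1
  funext x
  rcases x with i | i
  · rw [Sum.elim_inl, ← zpow_add₀ hϖ0]; norm_num
  · rw [Sum.elim_inr]; norm_num

/-- **`ϖ · 1` is central in `GSp(J, K)`.** [cite: AndrianovZhuravlev1995, Ch. 3 §3.3] -/
theorem similitudeTorusElt_two_neg_one_central {ϖ : K} (hϖ0 : ϖ ≠ 0) (x : symplecticSimilitudeGroup (Fin n) K) :
    x * similitudeTorusElt hϖ0 2 (fun _ : Fin n => (-1 : ℤ)) = similitudeTorusElt hϖ0 2 (fun _ : Fin n => (-1 : ℤ)) * x := by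
  refine Subtype.ext (Units.ext ?_)
  rw [Subgroup.coe_mul, Subgroup.coe_mul, Units.val_mul, Units.val_mul, coe_coe_similitudeTorusElt_two_neg_one,
    Matrix.mul_smul, Matrix.mul_one, Matrix.smul_mul, Matrix.one_mul]

/-- `⟨ρ, (1, …, 1)⟩ · 2 = n(n+1)` (`⟨ρ, (1,…,1)⟩ = Σᵢ (n - i) = n(n+1)/2`). [cite: CartierCorvallis1979, §IV (4.2)] -/
theorem symplecticRhoPairing_const_one : symplecticRhoPairing (fun _ : Fin n => (1 : ℤ)) * 2 = (n : ℤ) * (n + 1) := by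
  simp only [symplecticRhoPairing, mul_one]
  have h : ∀ m : ℕ, (∑ i : Fin m, ((m : ℤ) - (i : ℕ))) * 2 = (m : ℤ) * (m + 1) := by
    intro m
    induction m with
    | zero => simp
    | succ m ih =>
      rw [Fin.sum_univ_castSucc]
      simp only [Fin.val_castSucc, Fin.val_last, Nat.cast_succ]
      have h1 : (∑ i : Fin m, ((m : ℤ) + 1 - (i : ℕ))) = (∑ i : Fin m, ((m : ℤ) - (i : ℕ))) + m := by
        rw [show (∑ i : Fin m, ((m : ℤ) + 1 - (i : ℕ))) = ∑ i : Fin m, (((m : ℤ) - (i : ℕ)) + 1) from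
          Finset.sum_congr rfl fun i _ => by ring, Finset.sum_add_distrib]
        simp
      rw [h1]
      nlinarith [ih]
  exact h n

/-- The exponents of `ϖ · 1 = t(2, -1)`: `(a, c) = ((1, …, 1), 2)`. [cite: AndrianovZhuravlev1995, Ch. 3 §3.3] -/
theorem similitudeIwasawaExp_smul_one [Valued K ℤᵐ⁰] {ϖ : K} [NeZero n] (hϖ : Valued.v ϖ = WithZero.exp (-1 : ℤ)) :
    similitudeIwasawaExp hϖ (similitudeTorusElt (uniformizer_ne_zero hϖ) 2 (fun _ : Fin n => (-1 : ℤ)) :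
      symplecticSimilitudeGroup (Fin n) K) = ((fun _ : Fin n => (1 : ℤ)), (2 : ℤ)) := by
  rw [similitudeIwasawaExp_similitudeTorusElt]
  exact Prod.ext (funext fun _ => by norm_num) rfl

variable [Valued K ℤᵐ⁰] {ϖ : K} [NeZero n] {R : Type*} [CommRing R]
  [IsHeckeTriple (⊤ : Submonoid (symplecticSimilitudeGroup (Fin n) K)) (symplecticSimilitudeInt (Fin n) K)
    (symplecticSimilitudeInt (Fin n) K)]

/-- **`𝒮(Δ) = q^{⟨ρ, (1,…,1)⟩} x^{((1,…,1), 2)}`** for `Δ = T_{ϖ·1} = [K₀ (ϖ·1) K₀]` (a single coset: `ϖ·1` is central;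
exponents `(a, c)(ϖ·1) = ((1,…,1), 2)`). [cite: AndrianovZhuravlev1995, Ch. 3 §3.3] [cite: CartierCorvallis1979, §IV (4.2)] -/
theorem similitudeSatakeTransform_delta (hϖ : Valued.v ϖ = WithZero.exp (-1 : ℤ)) (q : Rˣ) :
    similitudeSatakeTransform hϖ q (heckeAlgebra.doubleCosetOperator (symplecticSimilitudeInt (Fin n) K)
      (similitudeTorusElt (uniformizer_ne_zero hϖ) 2 (fun _ : Fin n => (-1 : ℤ)))) =
      AddMonoidAlgebra.single ((fun _ : Fin n => (1 : ℤ)), (2 : ℤ))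
        ((q ^ symplecticRhoPairing (fun _ : Fin n => (1 : ℤ)) : Rˣ) : R) := by
  rw [similitudeSatakeTransform_eq, (isIwasawaExponent_similitude hϖ).satakeTransform_doubleCosetOperator_of_central _
    (fun x => similitudeTorusElt_two_neg_one_central _ x), similitudeIwasawaExp_smul_one, similitudeSatakeWeight_ofAdd]

/-- **`λ_χ(Δ) = q^{⟨ρ,(1,…,1)⟩} χ((1,…,1), 2)`.** [cite: AndrianovZhuravlev1995, Ch. 3 §3.3] -/
theorem similitudeHeckeEigencharacter_delta (hϖ : Valued.v ϖ = WithZero.exp (-1 : ℤ)) (q : Rˣ)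
    (χ : Multiplicative ((Fin n → ℤ) × ℤ) →* R) :
    similitudeHeckeEigencharacter hϖ q χ (heckeAlgebra.doubleCosetOperator (symplecticSimilitudeInt (Fin n) K)
      (similitudeTorusElt (uniformizer_ne_zero hϖ) 2 (fun _ : Fin n => (-1 : ℤ)))) =
      ((q ^ symplecticRhoPairing (fun _ : Fin n => (1 : ℤ)) : Rˣ) : R) *
        χ (Multiplicative.ofAdd ((fun _ : Fin n => (1 : ℤ)), (2 : ℤ))) := by
  rw [similitudeHeckeEigencharacter, (isIwasawaExponent_similitude hϖ).heckeEigencharacter_doubleCosetOperator_of_central _ _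
    (fun x => similitudeTorusElt_two_neg_one_central _ x), similitudeIwasawaExp_smul_one, similitudeSatakeWeight_ofAdd]

end SymplecticCartan

end Literature.NumberTheory.Automorphic

end
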